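import Summits.FinalStateConjecture.FinalStateConjecture.Theorems.EIHFluxBalanceRecedingWellsPotential
import Summits.FinalStateConjecture.FinalStateConjecture.Theses.EIHFluxBalance

/-!
# Route EIHFluxBalance — proof of `RecedingWellsEnergyBound` (item stmt-FinalStateConjecture-10168)

The support item `RecedingWellsEnergyBound` of route EIHFluxBalance (the 1+1 toy falsifier of the
modulated-energy layer, card K3): for a smooth non-negative compactly supported potential `V` and a
speed `0 < v < 1` there is `C = C(V, v)` such that every `C²` solution of
`u_tt − u_xx + (V(x − vt) + V(x + vt)) u = 0` with compactly supported Cauchy data satisfies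
`E(t) ≤ C·E(0)` for all `t ≥ 0`, `E(t) = ∫ (u_t² + u_x² + (V(x−vt)+V(x+vt)) u²) dx`.

Proof (`energy_bound_uncurried`, then the curried transfer `recedingWellsEnergyBound_proof`).
Let `supp V ⊆ (−R, R)`, `|V'| ≤ C₁`, `B = 2vC₁ ≥ sup ∂ₜW`, `T₁ = 2R/v`.
* `V ≡ 0`: the energy is conserved (`energy_late_le` with `β = 0`), `C = 1`.
* `V ≢ 0`, early times `t ≤ T₁`: `E(t) ≤ e^{(B+2)t}(E(0) + ∫ χ u(0,·)²)` for a bump `χ = 1` on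
  `|x| ≤ 3R` (`energy_early_le`), and the potential-anchored Poincaré inequality
  (`integral_sq_le_poincare_anchored`, anchor where `V ≥ V(x₀)/2 > 0`) gives
  `∫ χ u(0,·)² ≤ C_P E(0)` with `C_P = C_P(V)`.
* `V ≢ 0`, late times `t ≥ T₁` (wells separated): the Doppler multiplier `β = vφ(x/b(t))` of
  `exists_dopplerWeight` equals the well velocity on each well and interpolates causally across
  the potential-free gap, so `(1 − v)E(t) ≤ (1 + v)E(T₁)` (`energy_late_le`).
Altogether `C = (1+v)/(1−v) · e^{(B+2)T₁} · (1 + C_P)`; the blow-up as `v → 1` is the single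
head-on Doppler blue-shift `(1+v)/(1−v)` found numerically by the refuters (evidence on the item).
Finite speed of propagation (`EIHFluxBalanceRecedingWellsFiniteSpeed`) makes every `∫` over `ℝ` an
honest integral of a compactly supported continuous function.  Elementary; no named facts.
-/

namespace Summit.FinalStateConjecture.FinalStateConjecture.Theorems

open MeasureTheory Set Filter Topology intervalIntegral

noncomputable section

namespace MovingWells

open WaveEnergy

/-! ### The energy bound in Fréchet form -/

/-- **`RecedingWellsEnergyBound`, uncurried Fréchet form.** For `V ≥ 0` of class `C¹` with
compact support and `0 < v < 1` there is `C` such that for every `C²` function `U : ℝ × ℝ → ℝ`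
with compactly supported Cauchy data solving `U_tt − U_xx + (V(x − vt) + V(x + vt)) U = 0` on
`ℝ × ℝ`, the energy `∫ e(t, ·)`, `e = U_t² + U_x² + (V(x − vt) + V(x + vt)) U²`, is at most
`C ∫ e(0, ·)` for all `t ≥ 0`. -/
theorem energy_bound_uncurried {V : ℝ → ℝ} (hV : ContDiff ℝ 1 V) (hVc : HasCompactSupport V)
    (hV0 : ∀ x, 0 ≤ V x) {v : ℝ} (hv : 0 < v) (hv1 : v < 1) :
    ∃ C : ℝ, ∀ (U e : ℝ × ℝ → ℝ), ContDiff ℝ 2 U →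
      (∀ z, e z = (fderiv ℝ U z (1, 0)) ^ 2 + (fderiv ℝ U z (0, 1)) ^ 2
        + (V (z.2 - v * z.1) + V (z.2 + v * z.1)) * U z ^ 2) →
      (∃ R₁ : ℝ, ∀ y, R₁ ≤ |y| → U (0, y) = 0 ∧ fderiv ℝ U (0, y) (1, 0) = 0) →
      (∀ z : ℝ × ℝ, fderiv ℝ (fderiv ℝ U) z (1, 0) (1, 0) - fderiv ℝ (fderiv ℝ U) z (0, 1) (0, 1)
        + (V (z.2 - v * z.1) + V (z.2 + v * z.1)) * U z = 0) →
      ∀ t : ℝ, 0 ≤ t → ∫ x, e (t, x) ≤ C * ∫ x, e (0, x) := by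
  obtain ⟨R, hR, hVR, hVsupp⟩ := potential_support hVc
  obtain ⟨C₁, hC₁⟩ := (hVc.deriv).exists_bound_of_continuous (hV.continuous_deriv le_rfl)
  have hC₁0 : 0 ≤ C₁ := le_trans (norm_nonneg _) (hC₁ 0)
  have hC₁' : ∀ y, |deriv V y| ≤ C₁ := fun y => by simpa [Real.norm_eq_abs] using hC₁ y
  obtain ⟨W, hWz⟩ : ∃ W : ℝ × ℝ → ℝ, ∀ z, W z = V (z.2 - v * z.1) + V (z.2 + v * z.1) :=
    ⟨_, fun z => rfl⟩
  obtain ⟨hW1, hWfd⟩ := recedingWells_fderiv hV v hWz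
  have hW0 : ∀ z, 0 ≤ W z := fun z => by rw [hWz]; exact add_nonneg (hV0 _) (hV0 _)
  obtain ⟨B, hB⟩ : ∃ B : ℝ, B = 2 * v * C₁ := ⟨_, rfl⟩
  have hB0 : 0 ≤ B := by rw [hB]; positivity
  have hWt_abs : ∀ t x, |fderiv ℝ W (t, x) (1, 0)| ≤ B := by
    intro t x
    rw [(hWfd t x).1]
    have h1 := hC₁' (x - v * t)
    have h2 := hC₁' (x + v * t)
    calc |-v * deriv V (x - v * t) + v * deriv V (x + v * t)|
        ≤ |-v * deriv V (x - v * t)| + |v * deriv V (x + v * t)| := abs_add_le _ _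
      _ = v * |deriv V (x - v * t)| + v * |deriv V (x + v * t)| := by
          rw [abs_mul, abs_mul, abs_neg, abs_of_pos hv]
      _ ≤ v * C₁ + v * C₁ := add_le_add (mul_le_mul_of_nonneg_left h1 hv.le)
          (mul_le_mul_of_nonneg_left h2 hv.le)
      _ = B := by rw [hB]; ring
  have hWt : ∀ z, fderiv ℝ W z (1, 0) ≤ B := fun z => (le_abs_self _).trans (hWt_abs z.1 z.2)
  obtain ⟨T₁, hT₁⟩ : ∃ T₁ : ℝ, T₁ = 2 * R / v := ⟨_, rfl⟩
  have hT₁0 : 0 ≤ T₁ := by rw [hT₁]; positivity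
  have hvT₁ : v * T₁ = 2 * R := by rw [hT₁]; field_simp
  -- hypotheses in `W`-form and non-negativity of the energy
  have heW : ∀ (U e : ℝ × ℝ → ℝ), (∀ z, e z = (fderiv ℝ U z (1, 0)) ^ 2
      + (fderiv ℝ U z (0, 1)) ^ 2 + (V (z.2 - v * z.1) + V (z.2 + v * z.1)) * U z ^ 2) →
      ∀ z, e z = (fderiv ℝ U z (1, 0)) ^ 2 + (fderiv ℝ U z (0, 1)) ^ 2 + W z * U z ^ 2 :=
    fun U e he z => by rw [hWz]; exact he z
  have hsolW : ∀ U : ℝ × ℝ → ℝ, (∀ z : ℝ × ℝ, fderiv ℝ (fderiv ℝ U) z (1, 0) (1, 0)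
      - fderiv ℝ (fderiv ℝ U) z (0, 1) (0, 1) + (V (z.2 - v * z.1) + V (z.2 + v * z.1)) * U z = 0) →
      ∀ z : ℝ × ℝ, fderiv ℝ (fderiv ℝ U) z (1, 0) (1, 0)
        - fderiv ℝ (fderiv ℝ U) z (0, 1) (0, 1) + W z * U z = 0 :=
    fun U hsol z => by rw [hWz]; exact hsol z
  have hEpos : ∀ (U e : ℝ × ℝ → ℝ), (∀ z, e z = (fderiv ℝ U z (1, 0)) ^ 2
      + (fderiv ℝ U z (0, 1)) ^ 2 + W z * U z ^ 2) →
      ∀ s, 0 ≤ ∫ x, e (s, x) := fun U e he s =>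
    integral_nonneg fun x => WaveDefect.energyDensity_nonneg (u := U) hW0 he (s, x)
  by_cases hVz : ∀ x, V x = 0
  · -- `V ≡ 0`: conservation of energy, `C = 1`
    refine ⟨1, fun U e hU he hdata hsol t ht => ?_⟩
    obtain ⟨R₁, hdata⟩ := hdata
    have he' := heW U e he
    have hsol' := hsolW U hsol
    have hV' : ∀ y, deriv V y = 0 := by
      have : V = fun _ => 0 := funext hVz
      intro y; rw [this]; simp
    have key := energy_late_le (u := U) (W := W) hU hW1 hW0 hWt hsol' he' hdata
      (β := fun _ => (0 : ℝ)) contDiff_const (v := 0) le_rfl ht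
      (fun s _ x => by simp) (fun s _ x => by simp) (fun s _ x => by simp)
      (fun s _ x => by rw [(hWfd s x).1, hV', hV']; simp)
    simpa using key
  · -- `V ≢ 0`
    push Not at hVz
    obtain ⟨x₀, hx₀⟩ := hVz
    have hVx₀ : 0 < V x₀ := lt_of_le_of_ne (hV0 x₀) (Ne.symm hx₀)
    obtain ⟨δ₀, hδ₀, hδ₀V⟩ := Metric.continuousAt_iff.mp (hV.continuous.continuousAt (x := x₀))
      (V x₀ / 2) (by linarith)
    obtain ⟨δ, hδdef⟩ : ∃ δ : ℝ, δ = min (δ₀ / 2) 1 := ⟨_, rfl⟩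
    have hδ : 0 < δ := by rw [hδdef]; exact lt_min (by linarith) one_pos
    have hδ1 : δ ≤ 1 := by rw [hδdef]; exact min_le_right _ _
    have hδ2 : δ ≤ δ₀ / 2 := by rw [hδdef]; exact min_le_left _ _
    obtain ⟨μ, hμdef⟩ : ∃ μ : ℝ, μ = V x₀ / 2 := ⟨_, rfl⟩
    have hμ : 0 < μ := by rw [hμdef]; positivity
    have hanchor : ∀ y ∈ Icc (x₀ - δ) (x₀ + δ), μ ≤ V y := by
      intro y hy
      have hdist : dist y x₀ < δ₀ := by
        rw [Real.dist_eq, abs_lt]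
        constructor <;> linarith [hy.1, hy.2]
      have h := hδ₀V hdist
      rw [Real.dist_eq, abs_lt] at h
      rw [hμdef]
      linarith [h.1]
    have hx₀R : |x₀| < R := hVsupp x₀ hx₀
    obtain ⟨L', hL'⟩ : ∃ L' : ℝ, L' = 3 * R + 1 := ⟨_, rfl⟩
    have hL'0 : 0 ≤ L' := by rw [hL']; positivity
    have hL'1 : -L' ≤ x₀ - δ := by
      have := neg_abs_le x₀
      linarith
    have hL'2 : x₀ + δ ≤ L' := by
      have := le_abs_self x₀
      linarith
    obtain ⟨CP, hCP⟩ : ∃ CP : ℝ, CP = 2 * L' * ((δ * μ)⁻¹ * (1 / 2) + 4 * L') := ⟨_, rfl⟩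
    have hCP0 : 0 ≤ CP := by rw [hCP]; positivity
    obtain ⟨C, hC⟩ : ∃ C : ℝ, C = (1 + v) / (1 - v) * Real.exp ((B + 2) * T₁) * (1 + CP) :=
      ⟨_, rfl⟩
    -- the cut-off
    obtain ⟨χ, hχC, hχ0, hχ1, hχone, hχzero⟩ := exists_cutoff hR
    -- `W_t ≤ B χ` on `[0, T₁]`
    have hWχ : ∀ s ∈ Icc 0 T₁, ∀ x, fderiv ℝ W (s, x) (1, 0) ≤ B * χ x := by
      intro s hs x
      rcases le_or_gt |x| (3 * R) with hx | hx
      · rw [hχone x hx, mul_one]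
        exact hWt (s, x)
      · have hvs : v * s ≤ 2 * R := by
          calc v * s ≤ v * T₁ := mul_le_mul_of_nonneg_left hs.2 hv.le
            _ = 2 * R := hvT₁
        have hvs0 : 0 ≤ v * s := mul_nonneg hv.le hs.1
        have h1 : R ≤ |x - v * s| := by
          rcases le_or_gt 0 x with hx' | hx'
          · rw [abs_of_nonneg hx'] at hx
            rw [abs_of_nonneg (by linarith)]; linarith
          · rw [abs_of_neg hx'] at hx
            rw [abs_of_neg (by linarith)]; linarith
        have h2 : R ≤ |x + v * s| := by
          rcases le_or_gt 0 x with hx' | hx'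
          · rw [abs_of_nonneg hx'] at hx
            rw [abs_of_nonneg (by linarith)]; linarith
          · rw [abs_of_neg hx'] at hx
            rw [abs_of_neg (by linarith)]; linarith
        rw [(hWfd s x).1, (hVR _ h1).2, (hVR _ h2).2]
        simp only [mul_zero, add_zero]
        exact mul_nonneg hB0 (hχ0 x)
    -- the Doppler weight
    obtain ⟨β, hβC, hβ⟩ := exists_dopplerWeight hv hv1.le hR
    refine ⟨C, fun U e hU he₀ hdata hsol₀ t ht => ?_⟩
    obtain ⟨R₁, hdata⟩ := hdata
    have he := heW U e he₀
    have hsol := hsolW U hsol₀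
    have hUd := differentiable_of_contDiff_two hU
    have hE0 := hEpos U e he 0
    -- Step 1: the cut-off mass at `t = 0` is controlled by the energy (Poincaré)
    have hmass : ∫ x, χ x * U (0, x) ^ 2 ≤ CP * ∫ x, e (0, x) := by
      have hvan0 : ∀ y, |R₁| + L' ≤ |y| → ∀ w, U (0, y) = 0 ∧ fderiv ℝ U (0, y) w = 0 :=
        fun y hy w => eq_zero_of_abs_ge hU hW1 hW0 hWt hsol hdata le_rfl
          (le_trans (by linarith [le_abs_self R₁]) hy) w
      rw [hCP]
      exact cutoff_mass_le_energy hV hV0 v hδ hμ hanchor hL'0 hL'1 hL'2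
        (by linarith [abs_nonneg R₁]) hχC.continuous hχ1 (fun x hx => hχzero x (hL' ▸ hx))
        hU he₀ hvan0
    -- Step 2: early times
    have hearly : ∀ s ∈ Icc 0 T₁, ∫ x, e (s, x)
        ≤ Real.exp ((B + 2) * T₁) * (1 + CP) * ∫ x, e (0, x) := by
      intro s hs
      have h := energy_early_le hU hW1 hW0 hB0 hWt hsol he hdata hχC hχ0 hχ1 hWχ hs
      have hexp : Real.exp ((B + 2) * s) ≤ Real.exp ((B + 2) * T₁) :=
        Real.exp_le_exp.mpr (mul_le_mul_of_nonneg_left hs.2 (by linarith))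
      have hM0 : 0 ≤ ∫ x, χ x * U (0, x) ^ 2 :=
        integral_nonneg (f := fun x => χ x * U (0, x) ^ 2) fun x =>
          mul_nonneg (hχ0 x) (sq_nonneg (U (0, x)))
      have hm2 : (∫ x, e (0, x)) + ∫ x, χ x * U (0, x) ^ 2 ≤ (1 + CP) * ∫ x, e (0, x) := by
        calc (∫ x, e (0, x)) + ∫ x, χ x * U (0, x) ^ 2
            ≤ (∫ x, e (0, x)) + CP * ∫ x, e (0, x) := add_le_add le_rfl hmass
          _ = (1 + CP) * ∫ x, e (0, x) := by ring
      calc ∫ x, e (s, x) ≤ Real.exp ((B + 2) * s) * ((∫ x, e (0, x)) + ∫ x, χ x * U (0, x) ^ 2) := h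
        _ ≤ Real.exp ((B + 2) * T₁) * ((1 + CP) * ∫ x, e (0, x)) :=
            mul_le_mul hexp hm2 (add_nonneg hE0 hM0) (Real.exp_pos _).le
        _ = Real.exp ((B + 2) * T₁) * (1 + CP) * ∫ x, e (0, x) := by ring
    -- Step 3: late times
    have hCge : Real.exp ((B + 2) * T₁) * (1 + CP) ≤ C := by
      rw [hC]
      have h1 : 1 ≤ (1 + v) / (1 - v) := by
        rw [le_div_iff₀ (by linarith)]; linarith
      have h2 : 0 ≤ Real.exp ((B + 2) * T₁) * (1 + CP) := by positivity
      nlinarith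
    rcases le_or_gt t T₁ with htT | htT
    · calc ∫ x, e (t, x) ≤ Real.exp ((B + 2) * T₁) * (1 + CP) * ∫ x, e (0, x) := hearly t ⟨ht, htT⟩
        _ ≤ C * ∫ x, e (0, x) := mul_le_mul_of_nonneg_right hCge hE0
    · have hlate := energy_late_le (u := U) (W := W) hU hW1 hW0 hWt hsol he hdata hβC hT₁0 htT.le
        (fun s hs x => (hβ s (hT₁ ▸ hs.1) x).1) (fun s hs x => (hβ s (hT₁ ▸ hs.1) x).2.1)
        (fun s hs x => (dopplerWeight_kills hv hR hVR hWz hWfd hβ hT₁ hs.1 x).1)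
        (fun s hs x => (dopplerWeight_kills hv hR hVR hWz hWfd hβ hT₁ hs.1 x).2)
      have hT := hearly T₁ ⟨hT₁0, le_rfl⟩
      have h1v : 0 < 1 - v := by linarith
      rw [hC]
      have : ∫ x, e (t, x) ≤ (1 + v) / (1 - v) * ∫ x, e (T₁, x) := by
        rw [div_mul_eq_mul_div, le_div_iff₀ h1v]
        linarith
      calc ∫ x, e (t, x) ≤ (1 + v) / (1 - v) * ∫ x, e (T₁, x) := this
        _ ≤ (1 + v) / (1 - v) * (Real.exp ((B + 2) * T₁) * (1 + CP) * ∫ x, e (0, x)) :=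
            mul_le_mul_of_nonneg_left hT (by positivity)
        _ = (1 + v) / (1 - v) * Real.exp ((B + 2) * T₁) * (1 + CP) * ∫ x, e (0, x) := by ring

end MovingWells

/-! ### The route item -/

open WaveEnergy MovingWells in

/-- **Item stmt-FinalStateConjecture-10168 (`RecedingWellsEnergyBound`) holds.** For a smooth
non-negative compactly supported `V` and `0 < v < 1` there is `C = C(V, v)` such that every `C²`
solution `u : ℝ → ℝ → ℝ` of `u_tt − u_xx + (V(x − vt) + V(x + vt)) u = 0` (nested `deriv`s, as in the
route decl) with compactly supported Cauchy data satisfies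
`∫ (u_t² + u_x² + (V(x−vt)+V(x+vt))u²)(t,·) ≤ C ∫ (u_t² + u_x² + 2V u²)(0,·)` for all `t ≥ 0`.
(Dictionary `deriv`/slices ↔ `fderiv`, then `energy_bound_uncurried`.) -/
theorem recedingWellsEnergyBound_proof :
    Summit.FinalStateConjecture.FinalStateConjecture.Theses.EIHFluxBalance.RecedingWellsEnergyBound := by
  intro V v hV hVc hV0 hv hv1
  have hV1 : ContDiff ℝ 1 V := hV.of_le (by exact_mod_cast le_top)
  obtain ⟨C, hC⟩ := energy_bound_uncurried hV1 hVc hV0 hv hv1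
  refine ⟨C, fun u hu hc0 hc1 hpde t ht => ?_⟩
  set U : ℝ × ℝ → ℝ := fun p => u p.1 p.2 with hUdef
  have hUc : ContDiff ℝ 2 U := hu
  have hUd := differentiable_of_contDiff_two hUc
  have h1 : ∀ t x, deriv (fun s => u s x) t = fderiv ℝ U (t, x) (1, 0) := fun t x =>
    (hasDerivAt_slice_fst hUd t x).deriv
  have h2 : ∀ t x, deriv (u t) x = fderiv ℝ U (t, x) (0, 1) := fun t x =>
    (hasDerivAt_slice_snd hUd t x).deriv
  have h11 : ∀ t x, deriv (fun s => deriv (fun s' => u s' x) s) t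
      = fderiv ℝ (fderiv ℝ U) (t, x) (1, 0) (1, 0) := by
    intro t x
    have : (fun s => deriv (fun s' => u s' x) s) = fun s => fderiv ℝ U (s, x) (1, 0) :=
      funext fun s => h1 s x
    rw [this]
    exact (hasDerivAt_fderiv_apply_slice_fst hUc (1, 0) t x).deriv
  have h22 : ∀ t x, deriv (fun y => deriv (u t) y) x
      = fderiv ℝ (fderiv ℝ U) (t, x) (0, 1) (0, 1) := by
    intro t x
    have : (fun y => deriv (u t) y) = fun y => fderiv ℝ U (t, y) (0, 1) :=
      funext fun y => h2 t y
    rw [this]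
    exact (hasDerivAt_fderiv_apply_slice_snd hUc (0, 1) t x).deriv
  -- compactly supported data
  obtain ⟨r₀, hr₀⟩ := hc0.isCompact.isBounded.subset_closedBall (0 : ℝ)
  obtain ⟨r₁, hr₁⟩ := hc1.isCompact.isBounded.subset_closedBall (0 : ℝ)
  have hdata : ∀ y, max r₀ r₁ + 1 ≤ |y| → U (0, y) = 0 ∧ fderiv ℝ U (0, y) (1, 0) = 0 := by
    intro y hy
    have hy0 : y ∉ tsupport (u 0) := by
      intro hmem
      have := hr₀ hmem
      rw [Metric.mem_closedBall, dist_zero_right, Real.norm_eq_abs] at this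
      linarith [le_max_left r₀ r₁]
    have hy1 : y ∉ tsupport (fun x => deriv (fun t => u t x) 0) := by
      intro hmem
      have := hr₁ hmem
      rw [Metric.mem_closedBall, dist_zero_right, Real.norm_eq_abs] at this
      linarith [le_max_right r₀ r₁]
    have h0 : u 0 y = 0 := image_eq_zero_of_notMem_tsupport hy0
    have h0' : (fun x => deriv (fun t => u t x) 0) y = 0 :=
      image_eq_zero_of_notMem_tsupport (f := fun x => deriv (fun t => u t x) 0) hy1
    refine ⟨h0, ?_⟩
    rw [← h1]
    exact h0'
  -- the equation in Fréchet form
  have hsol : ∀ z : ℝ × ℝ, fderiv ℝ (fderiv ℝ U) z (1, 0) (1, 0)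
      - fderiv ℝ (fderiv ℝ U) z (0, 1) (0, 1) + (V (z.2 - v * z.1) + V (z.2 + v * z.1)) * U z = 0 := by
    rintro ⟨t', x'⟩
    have h := hpde t' x'
    rw [h11, h22] at h
    exact h
  set e : ℝ × ℝ → ℝ := fun z => (fderiv ℝ U z (1, 0)) ^ 2 + (fderiv ℝ U z (0, 1)) ^ 2
    + (V (z.2 - v * z.1) + V (z.2 + v * z.1)) * U z ^ 2 with hedef
  have he : ∀ z, e z = (fderiv ℝ U z (1, 0)) ^ 2 + (fderiv ℝ U z (0, 1)) ^ 2
      + (V (z.2 - v * z.1) + V (z.2 + v * z.1)) * U z ^ 2 := fun z => rfl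
  have key := hC U e hUc he ⟨max r₀ r₁ + 1, hdata⟩ hsol t ht
  have hl : (fun x => deriv (fun s => u s x) t ^ 2 + deriv (u t) x ^ 2
      + (V (x - v * t) + V (x + v * t)) * u t x ^ 2) = fun x => e (t, x) := by
    funext x
    rw [h1, h2]
  have hr : (fun x => deriv (fun s => u s x) 0 ^ 2 + deriv (u 0) x ^ 2 + (V x + V x) * u 0 x ^ 2)
      = fun x => e (0, x) := by
    funext x
    rw [h1, h2, he]
    simp [hUdef]
  rw [hl, hr]
  exact key

end

end Summit.FinalStateConjecture.FinalStateConjecture.Theorems
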